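import Summits.QuantumAdvantage.QuantumAdvantage.Theorems.RingFrameBridge
import Summits.QuantumAdvantage.AdviceFreeQNC0.RingHardOdd
import Summits.QuantumAdvantage.AdviceFreeQNC0.AdviceFreeQNC0Three
import HarnessLib

/-!
# The SPARSE BRIDGE, part A: all-pattern ring hardness on any Dense-3 set of lengths gives the advice-free separation
(supports the ring-hardness items of the `p = 3` leaf, e.g. stmt-QuantumAdvantage-27380; parametric in the prime `p`)

Cell decomp-qadv, seat lens-5 («finite range + asymptotic regime + bridge»), generation 18 — tree twin of §1/§2/§4 of the
generation-17 node `IndexDial` (critic row 74v7: VERIFIED, law files endorsed).  NO NEW `Prop`: the node's currencies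
`RingHard8On S p` / `RingHardOddOn L p` / `Dense3 S` are spelled out as hypotheses.

The landed bridge `Theorems.hlfNotFAC0Mod_of_ringHard8` (RingFrameBridge.lean) reads the ring crux `RingHard8 p` at EVERY
multiplier `t = ⌊(N−1)/2⌋`.  But the relation family witnessing `AdviceFreeQNC0Sep p` is ours to choose: the `N × N` grid may
host a square cycle `GridCycle.square t` of any length `8t` with `2t < N`, so ring hardness is needed only along a set `S` of
multipliers that is DENSE-3 — every large `T` has some `t ∈ S` with `t ≤ T ≤ 3t` (then `N ≤ 8t` still holds and the
Razborov–Smolensky degree / error accounting of the tree's proof is verbatim).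

* `hlfNotFAC0Mod_of_hardOn` ★ — all-pattern ring hardness (threshold `θ < 1`, every polylog degree) at the lengths `8t`,
  `t ∈ S`, `S` Dense-3 ⟹ `HLFNotFAC0Mod p`; `adviceFreeQNC0Sep_of_hardOn` composes with the landed
  `adviceFreeQNC0Sep_of_hlfNotFAC0Mod`; the case `S = univ` is the tree's landed bridge `Theorems.adviceFreeQNC0Sep_of_ringHard8` (the node's consistency restatement is omitted here, dedup).
* `card_rel_le_of_odd` — pointwise give-away of the even class (odd-class bound `θ·2^(N−1)` ⟹ all-pattern bound
  `((1+θ)/2)·2^N`, from the tree's `card_even_class_le`); `adviceFreeQNC0Sep_of_oddHardOn` — the odd-class currency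
  (`RingHardOdd`-shape) at the lengths `8t`, `t ∈ S` suffices.
* `dense3_tower` — every geometric tower `{b·3^j}` (`b ≥ 1`) is Dense-3; hence the OFFER
  `adviceFreeQNC0Sep_of_oddHard_tower` / `adviceFreeQNC0Three_of_oddHard_tower` ★: a prover of ring hardness for the leaf
  may assume the ring length is `n = 8b·3^j` (any fixed base `b ≥ 1`; `b = 2`: `n = 16·3^j`) for all large `j`, at no cost
  to the leaf; `oddHard_tower_of_ringHardOdd` records that this hypothesis is WEAKER than `RingHardOdd p` by name.
-/

set_option linter.dupNamespace false

noncomputable section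

open scoped Classical

namespace Summit.QuantumAdvantage.QuantumAdvantage.Theorems.IndexDial

open Finset Polynomial
open Literature.Computability.Cryptography Literature.Computability.Complexity
open Literature.Computability.QuantumComplexity Literature.Computability.MetaComplexity
open Summit.QuantumAdvantage.AdviceFreeQNC0
open Summit.QuantumAdvantage.QuantumAdvantage.Theorems

/-! ## §1 Give-away of the even class, pointwise in the length -/

/-- POINTWISE give-away of the even class (the tree's `ringHardOfOdd`, read at ONE length): a `θ·2^(N−1)` bound on the
solved odd patterns gives a `((1+θ)/2)·2^N` bound on all solved patterns, because the even class has `≤ 2^(N−1)` patterns. -/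
theorem card_rel_le_of_odd {p : ℕ} [Fact p.Prime] {θ : ℝ} {N : ℕ} (hN : 1 ≤ N)
    (P : Fin N → Smolensky.CubeFn (ZMod p) N)
    (hodd : ((univ.filter fun x : Fin N → Bool =>
        OddZeros x ∧ RingHLF.Rel x (fun i => decide (P i x = 1))).card : ℝ) ≤ θ * (2 : ℝ) ^ (N - 1)) :
    ((univ.filter fun x : Fin N → Bool => RingHLF.Rel x (fun i => decide (P i x = 1))).card : ℝ) ≤
      (1 + θ) / 2 * (2 : ℝ) ^ N := by
  obtain ⟨n, rfl⟩ : ∃ n, N = n + 1 := ⟨N - 1, by omega⟩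
  rw [Nat.add_sub_cancel] at hodd
  set Sx := univ.filter fun x : Fin (n + 1) → Bool => RingHLF.Rel x (fun i => decide (P i x = 1)) with hSx
  have hsplit : Sx.card = (Sx.filter OddZeros).card + (Sx.filter fun x => ¬ OddZeros x).card :=
    (Finset.card_filter_add_card_filter_not _).symm
  have heven : (Sx.filter fun x => ¬ OddZeros x).card ≤ 2 ^ n := by
    refine le_trans (Finset.card_le_card ?_) card_even_class_le
    intro x hx
    rw [mem_filter] at hx ⊢
    exact ⟨mem_univ _, hx.2⟩
  have hoddS : ((Sx.filter OddZeros).card : ℝ) ≤ θ * 2 ^ n := by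
    refine le_trans ?_ hodd
    gcongr
    intro x hx
    rw [hSx, mem_filter, mem_filter] at hx
    rw [mem_filter]
    exact ⟨mem_univ _, hx.2, hx.1.2⟩
  have hS : (Sx.card : ℝ) ≤ 2 ^ n + θ * 2 ^ n := by
    have h1 : (Sx.card : ℝ) = ((Sx.filter OddZeros).card : ℝ) +
        ((Sx.filter fun x => ¬ OddZeros x).card : ℝ) := by
      rw [hsplit]; push_cast; ring
    have h2 : ((Sx.filter fun x => ¬ OddZeros x).card : ℝ) ≤ 2 ^ n := by exact_mod_cast heven
    linarith
  have hpow : (2 : ℝ) ^ (n + 1) = 2 * 2 ^ n := by ring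
  calc (Sx.card : ℝ) ≤ 2 ^ n + θ * 2 ^ n := hS
    _ = (1 + θ) / 2 * (2 : ℝ) ^ (n + 1) := by rw [hpow]; ring

/-! ## §2 The sparse bridge -/

/-- Arithmetic: `N^K ≤ 2^{(log₂ N + 1)·K}` (copy of the tree's private lemma in RingFrameBridge). -/
private theorem pow_le_two_pow_log_succ_mul (N K : ℕ) :
    N ^ K ≤ 2 ^ ((Nat.log 2 N + 1) * K) := by
  rw [pow_mul]
  exact Nat.pow_le_pow_left (Nat.lt_pow_succ_log_self one_lt_two N).le K

/-- Arithmetic: the degree bound (copy of the tree's private lemma in RingFrameBridge). -/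
private theorem degree_bound {p K L d : ℕ} (hK : 1 ≤ K) (hp : 1 ≤ p - 1)
    (hA : (2 * (p - 1) * K) ^ (d + 1) ≤ L) :
    ((p - 1) * ((L + 1) * K)) ^ (d + 1) ≤ L ^ (d + 2) := by
  have hApos : 1 ≤ 2 * (p - 1) * K := by nlinarith
  have hL : 1 ≤ L := le_trans (Nat.one_le_pow _ _ hApos) hA
  calc ((p - 1) * ((L + 1) * K)) ^ (d + 1)
      ≤ (2 * (p - 1) * K * L) ^ (d + 1) := by
        apply Nat.pow_le_pow_left
        nlinarith
    _ = (2 * (p - 1) * K) ^ (d + 1) * L ^ (d + 1) := by rw [mul_pow]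
    _ ≤ L * L ^ (d + 1) := Nat.mul_le_mul_right _ hA
    _ = L ^ (d + 2) := by ring

/-- Arithmetic: the error term (copy of the tree's private lemma in RingFrameBridge). -/
private theorem error_bound {N k c : ℕ} {sN D δ : ℝ} (hN : 1 ≤ N) (hs : sN ≤ c * (N : ℝ) ^ k + c)
    (hδ : (2 * c + 2 : ℝ) ≤ δ * N) (hD : ((N : ℝ)) ^ (k + 3) ≤ D) (hDpos : 0 < D) :
    (N : ℝ) * N * (sN + 2) / D ≤ δ := by
  have hN' : (1 : ℝ) ≤ N := by exact_mod_cast hN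
  have hNk : (1 : ℝ) ≤ (N : ℝ) ^ k := one_le_pow₀ hN'
  rw [div_le_iff₀ hDpos]
  have h1 : sN + 2 ≤ (2 * c + 2) * (N : ℝ) ^ k := by nlinarith
  have h2 : (N : ℝ) * N * (sN + 2) ≤ (N : ℝ) * N * ((2 * c + 2) * (N : ℝ) ^ k) := by
    have : (0 : ℝ) ≤ (N : ℝ) * N := by positivity
    exact mul_le_mul_of_nonneg_left h1 this
  calc (N : ℝ) * N * (sN + 2) ≤ (N : ℝ) * N * ((2 * c + 2) * (N : ℝ) ^ k) := h2
    _ = (2 * c + 2) * (N : ℝ) ^ (k + 2) := by ring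
    _ ≤ δ * N * (N : ℝ) ^ (k + 2) := by
        have : (0 : ℝ) ≤ (N : ℝ) ^ (k + 2) := by positivity
        exact mul_le_mul_of_nonneg_right hδ this
    _ = δ * (N : ℝ) ^ (k + 3) := by ring
    _ ≤ δ * D := by
        have hδ0 : 0 ≤ δ := by
          have : (0 : ℝ) < 2 * c + 2 := by positivity
          nlinarith
        exact mul_le_mul_of_nonneg_left hD hδ0

/-- ★ **THE SPARSE BRIDGE.**  Let `S` be a set of multipliers that is DENSE-3 (`hS`: every `T ≥ T₀` has some `t ∈ S` with
`t ≤ T ≤ 3t`), and suppose ALL-PATTERN RING HARDNESS holds at the lengths `8t`, `t ∈ S` (`h`: some `θ < 1` such that for every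
degree exponent `c`, for all large `t ∈ S`, every `𝔽_p`-polynomial strategy of degree `≤ (log₂ (8t))^c` solves `RingHLF.Rel` on at
most `θ·2^(8t)` patterns — the tree's `RingHard8 p` asked only on `S`).  Then `HLFNotFAC0Mod p`.  Proof = the tree's
`hlfNotFAC0Mod_of_ringHard8` re-run with the grid cycle `GridCycle.square t` for `t ∈ S` chosen in `[⌊(N−1)/2⌋/3, ⌊(N−1)/2⌋]`. -/
theorem hlfNotFAC0Mod_of_hardOn (p : ℕ) [Fact p.Prime] {S : Set ℕ}
    (hS : ∃ T₀ : ℕ, ∀ T ≥ T₀, ∃ t ∈ S, t ≤ T ∧ T ≤ 3 * t)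
    (h : ∃ θ : ℝ, θ < 1 ∧ ∀ c : ℕ, ∃ t₀ : ℕ, ∀ t ≥ t₀, t ∈ S →
      ∀ P : Fin (8 * t) → Smolensky.CubeFn (ZMod p) (8 * t),
        (∀ i, P i ∈ Smolensky.lowDeg (ZMod p) (8 * t) ((Nat.log 2 (8 * t)) ^ c)) →
        ((univ.filter fun x : Fin (8 * t) → Bool =>
            RingHLF.Rel x (fun i => decide (P i x = 1))).card : ℝ) ≤ θ * (2 : ℝ) ^ (8 * t)) :
    HLFNotFAC0Mod p := by
  have hp := (Fact.out : p.Prime)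
  obtain ⟨θ₀, hθ₀, hhard⟩ := h
  obtain ⟨T₀, hT₀⟩ := hS
  set δ : ℝ := (1 - θ₀) / 2 with hδ
  have hδpos : 0 < δ := by rw [hδ]; linarith
  refine ⟨θ₀ + δ, by rw [hδ]; linarith, fun d s => ?_⟩
  -- size bound `s(N) ≤ cs N^ks + cs`
  obtain ⟨cs, ks, hcs⟩ := exists_eval_le_mul_pow_add s
  -- ring hardness at exponent `d + 2`, at multipliers in `S`
  obtain ⟨n₀, hn₀⟩ := hhard (d + 2)
  -- the thresholds
  set K : ℕ := ks + 3 with hK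
  set A : ℕ := 2 * (p - 1) * K with hA
  set M : ℕ := ⌈1 / δ⌉₊ with hM
  refine ⟨max (max (6 * n₀ + 13) (2 * T₀ + 1)) (max (M * (2 * cs + 2)) (2 ^ (A ^ (d + 1)))),
    fun N hN r Cs hover hdep hsize => ?_⟩
  have hN13 : 6 * n₀ + 13 ≤ N := le_trans (le_max_left _ _) (le_trans (le_max_left _ _) hN)
  have hNT₀ : 2 * T₀ + 1 ≤ N := le_trans (le_max_right _ _) (le_trans (le_max_left _ _) hN)
  have hNM : M * (2 * cs + 2) ≤ N := le_trans (le_max_left _ _) (le_trans (le_max_right _ _) hN)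
  have hNA : 2 ^ (A ^ (d + 1)) ≤ N := le_trans (le_max_right _ _) (le_trans (le_max_right _ _) hN)
  -- the cycle of length `8t` in the grid, `t ∈ S`
  obtain ⟨t, htS, htT, hTt⟩ := hT₀ ((N - 1) / 2) (by omega)
  have ht2 : 2 ≤ t := by omega
  have htN : 2 * t < N := by omega
  have hn3 : 3 ≤ 8 * t := by omega
  have hNn : N ≤ 8 * t := by omega
  have ht₀ : n₀ ≤ t := by omega
  let γ : GridCycle N (8 * t) := GridCycle.square t ht2 htN
  -- the Razborov–Smolensky parameter
  set L : ℕ := Nat.log 2 N with hL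
  set ℓ : ℕ := (L + 1) * K with hℓ
  have hℓ1 : 1 ≤ ℓ := by
    rw [hℓ, hK]; nlinarith
  -- degree: `((p-1)ℓ)^{d+1} ≤ (log₂ (8t))^{d+2}`
  have hAL : A ^ (d + 1) ≤ L := by
    rw [hL]
    exact Nat.le_log_of_pow_le one_lt_two hNA
  have hdeg : ((p - 1) * ℓ) ^ (d + 1) ≤ (Nat.log 2 (8 * t)) ^ (d + 2) := by
    have h1 : ((p - 1) * ℓ) ^ (d + 1) ≤ L ^ (d + 2) :=
      degree_bound (by rw [hK]; omega) (by have := hp.two_le; omega) (by rw [← hA]; exact hAL)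
    refine h1.trans (Nat.pow_le_pow_left ?_ _)
    rw [hL]
    exact Nat.log_mono_right hNn
  -- the polynomial-map bound from ring hardness at length `8t`, `t ∈ S`
  have hB : ∀ P : Fin (N * N) → Smolensky.CubeFn (ZMod p) (8 * t),
      (∀ j, P j ∈ Smolensky.lowDeg (ZMod p) (8 * t) (((p - 1) * ℓ) ^ (d + 1))) →
        ((univ.filter fun x : Fin (8 * t) → Bool =>
            (fun v => (fun j => decide (P j x = 1)) (finProdFinEquiv v)) ∈
              hlfSolutions (γ.ringInstance x)).card : ℝ) ≤ θ₀ * (2 : ℝ) ^ (8 * t) := by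
    intro P hP
    -- the ring outputs of `P`
    let Q : Fin (8 * t) → Smolensky.CubeFn (ZMod p) (8 * t) :=
      fun i => P (finProdFinEquiv (γ.toFun i))
    have hQ : ∀ i, Q i ∈ Smolensky.lowDeg (ZMod p) (8 * t) ((Nat.log 2 (8 * t)) ^ (d + 2)) :=
      fun i => Smolensky.lowDeg_mono hdeg (hP _)
    have hring := hn₀ t ht₀ htS Q hQ
    refine le_trans ?_ hring
    exact_mod_cast card_le_card fun x hx => by
      simp only [mem_filter, mem_univ, true_and] at hx ⊢
      exact GridCycle.rel_of_mem_hlfSolutions hn3 x hx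
  -- the relational Razborov–Smolensky lemma
  obtain ⟨x, hx⟩ := Smolensky.exists_uniformProb_le hℓ1
    (fun x : Fin (8 * t) → Bool => encodeHLF (γ.ringInstance x))
    (GridCycle.encodeHLF_ringInstance_subst γ)
    (fun j : Fin (N * N) => Cs (finProdFinEquiv.symm j))
    (fun j => hover _) (fun j => hdep _)
    (fun x z => (fun v => z (finProdFinEquiv v)) ∈ hlfSolutions (γ.ringInstance x)) hB
  refine ⟨γ.ringInstance x, GridCycle.ringInstance_isValid x, ?_⟩
  simp only [Equiv.symm_apply_apply] at hx
  refine hx.trans ?_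
  -- the two error terms
  have h2t : (2 : ℝ) ^ (8 * t) ≠ 0 := pow_ne_zero _ two_ne_zero
  rw [mul_div_assoc, div_self h2t, mul_one]
  refine add_le_add le_rfl ?_
  -- `Σ_j (size + 2) ≤ N²(s N + 2)` and `p^ℓ ≥ N^{ks+3}`
  have hpℓpos : (0 : ℝ) < (p : ℝ) ^ ℓ := by
    have : (0 : ℝ) < p := by exact_mod_cast hp.pos
    positivity
  have hsum : (∑ j : Fin (N * N), (((Cs (finProdFinEquiv.symm j)).size : ℝ) + 2)) ≤
      (N : ℝ) * N * (((s.eval N : ℕ) : ℝ) + 2) := by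
    calc (∑ j : Fin (N * N), (((Cs (finProdFinEquiv.symm j)).size : ℝ) + 2))
        ≤ ∑ _j : Fin (N * N), (((s.eval N : ℕ) : ℝ) + 2) :=
          sum_le_sum fun j _ => by
            have := hsize (finProdFinEquiv.symm j)
            exact add_le_add (by exact_mod_cast this) le_rfl
      _ = (N : ℝ) * N * (((s.eval N : ℕ) : ℝ) + 2) := by
          rw [sum_const, card_univ, Fintype.card_fin, nsmul_eq_mul]
          push_cast
          ring
  have hD : ((N : ℝ)) ^ (ks + 3) ≤ (p : ℝ) ^ ℓ := by
    have h1 : N ^ (ks + 3) ≤ 2 ^ ℓ := by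
      rw [hℓ, hK, hL]
      exact pow_le_two_pow_log_succ_mul N (ks + 3)
    have h2 : 2 ^ ℓ ≤ p ^ ℓ := Nat.pow_le_pow_left hp.two_le ℓ
    exact_mod_cast h1.trans h2
  have hMδ : (2 * cs + 2 : ℝ) ≤ δ * N := by
    have hM1 : (1 : ℝ) / δ ≤ M := by rw [hM]; exact Nat.le_ceil _
    have hMN : ((M * (2 * cs + 2) : ℕ) : ℝ) ≤ N := by exact_mod_cast hNM
    push_cast at hMN
    have hMδ' : 1 ≤ δ * (M : ℝ) := by
      rw [div_le_iff₀ hδpos] at hM1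
      linarith
    have h0 : (0 : ℝ) ≤ 2 * cs + 2 := by positivity
    calc (2 * cs + 2 : ℝ) = 1 * (2 * cs + 2) := by ring
      _ ≤ δ * (M : ℝ) * (2 * cs + 2) := mul_le_mul_of_nonneg_right hMδ' h0
      _ = δ * ((M : ℝ) * (2 * cs + 2)) := by ring
      _ ≤ δ * N := mul_le_mul_of_nonneg_left hMN hδpos.le
  calc (∑ j : Fin (N * N), (((Cs (finProdFinEquiv.symm j)).size : ℝ) + 2)) / (p : ℝ) ^ ℓ
      ≤ (N : ℝ) * N * (((s.eval N : ℕ) : ℝ) + 2) / (p : ℝ) ^ ℓ :=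
        div_le_div_of_nonneg_right hsum hpℓpos.le
    _ ≤ δ := error_bound (k := ks) (c := cs) (by omega) (by exact_mod_cast hcs N) hMδ hD hpℓpos

/-- ★ the composite: all-pattern ring hardness on ANY Dense-3 set of multipliers gives the advice-free separation
`AdviceFreeQNC0Sep p` (landed `adviceFreeQNC0Sep_of_hlfNotFAC0Mod`). -/
theorem adviceFreeQNC0Sep_of_hardOn (p : ℕ) [Fact p.Prime] {S : Set ℕ}
    (hS : ∃ T₀ : ℕ, ∀ T ≥ T₀, ∃ t ∈ S, t ≤ T ∧ T ≤ 3 * t)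
    (h : ∃ θ : ℝ, θ < 1 ∧ ∀ c : ℕ, ∃ t₀ : ℕ, ∀ t ≥ t₀, t ∈ S →
      ∀ P : Fin (8 * t) → Smolensky.CubeFn (ZMod p) (8 * t),
        (∀ i, P i ∈ Smolensky.lowDeg (ZMod p) (8 * t) ((Nat.log 2 (8 * t)) ^ c)) →
        ((univ.filter fun x : Fin (8 * t) → Bool =>
            RingHLF.Rel x (fun i => decide (P i x = 1))).card : ℝ) ≤ θ * (2 : ℝ) ^ (8 * t)) :
    AdviceFreeQNC0Sep p :=
  adviceFreeQNC0Sep_of_hlfNotFAC0Mod p (hlfNotFAC0Mod_of_hardOn p hS h)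

end Summit.QuantumAdvantage.QuantumAdvantage.Theorems.IndexDial
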